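import Summits.SmoothPoincare4.SmoothPoincare4.Theorems.ContractibleTwistedDoubleStandard.Negative.LoadBearing
import Summits.SmoothPoincare4.SmoothPoincare4.Theorems.ContractibleTwistedDoubleStandard.Negative.SphereAcyclicBisection
import Summits.SmoothPoincare4.SmoothPoincare4.Theorems.ContractibleTwistedDoubleStandard.Negative.ContactGluing
import Literature.Topology.FourManifolds.Gluing
import Literature.Topology.FourManifolds.Corks
import Literature.Barriers.SmoothPoincare4.ExoticContractible

/-!
# Disproof of `ContractibleTwistedDoubleStandard` — findings (standing disprover's work file, v9)

Crux (stmt-SmoothPoincare4-3546, route ConvexBisection, rank 4; FIXED, never restated here):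
`Summit.SmoothPoincare4.SmoothPoincare4.Theses.ConvexBisection.ContractibleTwistedDoubleStandard` —
a closed (T₂, second countable, compact) smooth 4-manifold `X` which is a Stein bisection along a
common contact seam of two compact CONTRACTIBLE Stein domains `(W₁,J₁)`, `(W₂,J₂)` (smooth
embeddings `e₁, e₂` covering `X`, meeting exactly in the images of both boundaries, pushed-forward
complex tangencies equal at common points) is diffeomorphic to the round `S⁴`.

VERDICT AFTER TWO CYCLES: **resists; not cheaply refutable.**  Every counterexample is an exotic
contact twisted double `W₁ ∪_ψ W̄₂` of contractible Stein domains, i.e. an exotic homotopy 4-sphere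
(van Kampen + Mayer–Vietoris on paper), so `¬crux ⇒ ¬SPC4`; conversely `SPC4 ⇒ crux`.  No junk
instance exists (audits of gen 1/2 and of refuters g44-9/g44-12: `SteinStructure.boundary_eq` +
`exists_isBoundaryPoint` exclude closed/pointlike halves; contractibility excludes `∅`).

## Index of CHECKED content (all `sorry`-free; landed files are imported, not copied)

LANDED under `Theorems/ContractibleTwistedDoubleStandard/Negative/` (gen 1–2, cycle 1):
* `DoubleBisection.lean` (p69875): (A1) `mfderiv_apply_mem_boundaryTangentSpace`, (A2)
  `exists_mfderiv_incl_eq`, (A3) `mfderiv_apply_eq_of_comp_incl_eq` / `map_mfderiv_eq_of_comp_incl_eq`;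
  `steinBisection_of_glue`, `steinBisection_of_isDouble` (EVERY double `D(W)` of a compact Stein
  domain is a Stein bisection along a common contact seam); `crux_hypotheses_at_sphere` +
  `contractibleSpace_closedBall_four` (NON-VACUITY: the round `S⁴ = 𝔻⁴ ∪ 𝔻⁴` with the standard
  Stein ball satisfies all six hypotheses with contractible halves — TIGHTNESS at `S⁴`);
  `double_standard_of_crux` (crux ⇒ doubles of contractible Stein domains are `S⁴` = the
  presentation-sphere sector `Σ(𝒫, ε)`, `ψ = id`; open — Gompf 1991, Meier–Zupan 1904.08527).
* `SphereAcyclicBisection.lean` (p70210): `acyclicBisection_sphere` (the sibling cruxes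
  `AcyclicBisectionExists/Rigidity` are non-vacuous at `S⁴`; this crux sits inside the acyclic one).
* `LoadBearing.lean` (p70693): `crux_iff_without_compactSpace` (`[CompactSpace X]` REDUNDANT),
  `not_crux_without_contractible` (CONTRACTIBILITY LOAD-BEARING; Lean witness: the empty bisection —
  junk but sufficient; honest witnesses `D(S¹×D³) = S¹×S³`, doubles of Stein rational balls are not
  constructible yet), `not_crux_without_cover` (COVER LOAD-BEARING; honest witness `S⁴ ⊔ S⁴`),
  `seam_mem_boundary`, `seam_nonempty`, `connectedSpace_of_bisection`, `isSmoothEmbedding_inl_comp`.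

NEW in cycle 2 (gen 3) — LANDED as `Negative/ContactGluing.lean` (p73479, commit 902a70d4c191), wrapped in §2:
* §2 `steinBisection_of_contactGluing`: a boundary gluing `W₁ ∪_ψ W₂` of two compact Stein domains
  along a CONTACTOMORPHISM `ψ` of abstract boundaries (`IsContacto`, the lines' predicate) satisfies
  the six crux hypotheses (converse half of the lines' `stub_seam`); `contactGluing_standard_of_crux`
  (crux ⇒ every contact twisted double of contractible Stein domains is `S⁴`);
  `contactCorkTwist_standard_of_crux` (crux ⊇ the CONTACT SECTOR OF GOMPF'S QUESTION 2.2: twists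
  `C ∪_τ C` by contactomorphisms `τ` of `ξ_J`); `crux_iff_minimal` (`[CompactSpace X]` AND
  `[SecondCountableTopology X]` REDUNDANT); and (work-file only, for the prover of `stub_seam`)
  `isContacto_of_matching` — the matching clause ⇒ `IsContacto ψ`, given `ψ` and injectivity of
  `deᵢ` at boundary points.  `[T2Space X]` is load-bearing ON PAPER (double a small
  interior ball of `𝔻⁴`: a non-Hausdorff compact contractible `SteinStructure`-domain, all axioms
  being local) — not formalised, nobody will drop it.
* §3 THE LINES' BETS, typed, with their exact falsifiers: `FillingUniqueness` (= `stub_fillingUniqueness`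
  of line legendrian-r-knot-rigidity), `ContactChirality` (= `stub_contactChirality`; the lever of
  legendrian-belt-unlinking's `stub_beltChirality` and of property-r-mazur-halves' bet in other
  clothes), `ContactCork` (F0-type object), `ExoticContactFillingPair` (F1-type object);
  `not_contactChirality_of_contactCork`, `not_fillingUniqueness_of_exoticContactFillingPair`,
  `contactCork_twist_standard_of_crux` (a contact cork kills the LINES, not the crux, unless its
  twist is exotic).
* §4 aliases collecting the cycle-1 theorems under this namespace (so this index elaborates).

## Stub census (14 registered stubs of the 3 lines; no lead yet, `targets = []`) — cheap attacks

SPC4-IMPLIED (refutable only by an exotic `S⁴`; no cheap kill possible): property-r-mazur-halves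
`stub_ballHalf`, `stub_oneHandleCancels` (any closing `X = P ∪ S¹×B³` is a homotopy sphere; SPC4 ⇒
`P = S⁴ ∖ ν(unknotted S¹) = S²×D²`, profile `(1,0,1)`), `stub_propertyRClosing`, `stub_nonMazurSector`;
legendrian-belt-unlinking `stub_steinDoubleStandard`; legendrian-r-knot-rigidity
`stub_presentationSpheres` (= stmt-3717 verbatim).  KNOWN / folklore modulo vendoring: `stub_seam`,
`stub_upsideDownLegendrianDual` (twisting `+1` sign re-derived: dual handle = 0-framed meridian,
standard Legendrian meridian `tb = −1`, `0 = −1 + 1` ✓), `stub_beltReading`, `stub_sliceBeltDouble`,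
`stub_doubleIsPresentationSphere`.  BETS (NOT SPC4-implied; refutable in principle, but every Lean
refutation needs a NON-BALL contractible Stein domain — none constructible, and the tree's cork
facts `akbulut1991_mazurCork` / `akbulutRuberman2016_theoremB` carry no Stein data):
`stub_fillingUniqueness`, `stub_contactChirality`, `stub_beltChirality`.  Ball/sphere instances
cannot kill them: a diffeomorphism preserving a contact plane field preserves the contact
orientation (`χ^*(α∧dα) = f²·α∧dα`), so every contactomorphism of `(S³, ξ_std)` is orientation
preserving and extends over `𝔻⁴` (Cerf `Γ₄ = 0`); on `S⁴ = 𝔻⁴ ∪ 𝔻⁴` the Lagrangian discs transfer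
as `D' = D`.  No stub is misstated as far as typing goes (all three skeletons `lean check` rc 0 per
their planners; binder shapes re-read here).

## Literature (page-checked; cycle 1 §5 + cycle 2)

* Open instances of the crux: Gompf arXiv:1603.05090 Q2.2 (cork twisting `S⁴`; p. 8), Tange
  arXiv:1609.04345 Conj 1.6 (twisted doubles of infinite-order corks), presentation spheres `Σ(𝒫,ε)`
  (`ψ = id`; Gompf 1991, Meier–Zupan arXiv:1904.08527 pp. 3–4); Dai–Mallick–Zemke arXiv:2312.08258
  (2024: many more corks `(C_{K,m}, t_λ)` from the swallow-follow; Gompf's Q1.6 on ℤ-corks) — none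
  comes with a contactomorphism.
* First test family is degenerate: on the Akbulut cork `τ` is no contactomorphism of the handlebody
  structure `ξ₁` (Akbulut–Karakurt arXiv:1104.2247 Thm 4.1/Cor 4.2–4.3 via `F_W(c⁺)`), the mixed
  pair `(J₁,J₂,τ)` is excluded by KOU arXiv:1607.07661 Thm 1.2, and for Ukida's PLANAR `ξ₂` the
  question F0 `τ^*ξ₂ ≃ ξ₂ ?` is HF-blind and OPEN (triage r1-1..3).  Boundary of the Akbulut cork:
  `Y⁻(0)` in Cavallo's notation, hyperbolic (`S³_{+1}` on the mirror of `9_46`, KOU L2.5–2.6) — NOT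
  `Σ(2,5,7)` (= `∂W⁻(3)`; Cavallo arXiv:2605.15095 p. 2, Akbulut–Kirby Thm 2).
* Sector exclusions: Cavallo arXiv:2605.15095 Thm 1.1 (2026): the Akbulut–Kirby Mazur manifolds
  `W⁻(m)`, `m = 2,3,4` (`∂ = Σ(2,3,13), Σ(2,5,7), Σ(3,4,5)`) carry NO symplectic, hence no Stein,
  structure; with Mark–Tosun arXiv:1603.07710 and Etnyre–Tosun arXiv:2004.07405 (Gompf's conjecture:
  no Brieskorn sphere bounds a Stein ℚ-acyclic domain) Seifert seams are conjecturally absent from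
  the crux altogether — the arena is hyperbolic/other ℤHS seams.
* BET 1 (`FillingUniqueness`): TRUE in the planar-`P₄` sector — Oba arXiv:1407.5257 (Geom. Dedicata
  2016): a Stein fillable ℤHS³ supported by an open book with page a 4-holed sphere has a UNIQUE Stein
  filling up to diffeomorphism; UNTESTED in general — Akbulut–Yasui arXiv:1208.1053 p. 1: for the
  cork-twist exotic Stein pairs of [AY5] "we do not know whether these exotic Stein manifolds induce
  the same contact 3-manifolds on their boundaries" (their same-contact exotic fillings have
  `b₂ = 2`, via Eliashberg–Polterovich on `T³`, unavailable at `b₂ = 0`).  SHARPEST INSTANCE (F1):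
  Akbulut–Yildiz arXiv:1901.00806 Thm 1 + Remark 1 — an exotic pair of contractible STEIN MAZUR
  manifolds `W₁, W₂` with common boundary `Y` and NO diffeomorphism `∂W₁ → ∂W₂` carrying belt circle
  to belt circle (answers Kirby 1.16); both induced structures have `d₃ = −1/2` and the unique spinᶜ
  structure, so they are homotopic as plane fields; deciding `ξ_{W₁} ≅ ξ_{W₂}` (contact class via
  bordered HF) kills BET 1 AND the contact Kirby–Melvin lemma CKM' if YES, and is uninformative if NO.
* BET 2 (`ContactChirality`) / `stub_beltChirality`: F0 above; the natural test bed is Nersisyan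
  arXiv:2606.24220 §1.2: zero-dot exchange decompositions `S⁴ = M₀ ∪_θ −M•` of dual Mazur manifolds
  with `θ` NOT extending to a diffeomorphism whenever `tb(M₀) > 0` — crux instances INSIDE `S⁴`
  exactly when `θ` is a contactomorphism for Stein structures on `M₀` and `−M•`; such a `θ` would
  refute BET 1 ∘ BET 2 (the lines) while the crux holds there by construction.

## Not formalisable here (near-misses, recorded for the provers)
* `crux ← SPC4` and `¬crux → ¬SPC4` need "such `X` is a homotopy 4-sphere" (van Kampen + MV +
  Whitehead): no π₁/Hurewicz in the tree; gen 1 proved it relative to that `Prop`.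
* Honest witness for `not_crux_without_contractible` (`D(S¹×D³) = S¹×S³`): needs a half-space atlas
  on `S¹×D³`, a `SteinStructure` on it and `S¹×S³ ≄ S⁴` — none in the tree.
* F0 / F1 are computations in contact topology (planar monodromy Hurwitz orbits; bordered-HF contact
  class), not Lean statements; `kit` has no such engine.
-/

noncomputable section

set_option linter.dupNamespace false
set_option linter.unusedVariables false

open scoped Manifold ContDiff Topology
open Set Function Literature.Geometry.Symplectic Literature.Topology.FourManifolds

namespace Summit.SmoothPoincare4.SmoothPoincare4.Cruxes.ContractibleTwistedDoubleStandard.Disproof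

open Summit.SmoothPoincare4.SmoothPoincare4.Theses.ConvexBisection
open Summit.SmoothPoincare4.SmoothPoincare4.Theorems.ContractibleTwistedDoubleStandard

/-! ## §1 The contactomorphism predicate (same body as the lines' `IsContacto`) -/

section Contacto

variable {W₁ : Type*} [TopologicalSpace W₁] [ChartedSpace (EuclideanHalfSpace 4) W₁]
  [IsManifold (𝓡∂ 4) ∞ W₁] [CompactSpace W₁]
  {W₂ : Type*} [TopologicalSpace W₂] [ChartedSpace (EuclideanHalfSpace 4) W₂]
  [IsManifold (𝓡∂ 4) ∞ W₂] [CompactSpace W₂]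

/-- `ψ : ∂W₁ → ∂W₂` is a contactomorphism `(∂W₁, ξ_{J₁}) → (∂W₂, ξ_{J₂})` in the differential sense
(verbatim the body of `IsContacto` in `Lines/legendrian-r-knot-rigidity.lean`, so the two are
definitionally equal): `d(incl₂ ∘ ψ)_z v ∈ ξ₂ ↔ d(incl₁)_z v ∈ ξ₁`.  No co-orientation is recorded,
exactly as in the crux's matching clause.  Geiges (2008) Def. 2.1.5. -/
def IsContacto (J₁ : SteinStructure W₁) (J₂ : SteinStructure W₂)
    (b₁ : BoundaryData (𝓡∂ 4) W₁ (𝓡 3)) (b₂ : BoundaryData (𝓡∂ 4) W₂ (𝓡 3))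
    (ψ : b₁.carrier → b₂.carrier) : Prop :=
  ∀ (z : b₁.carrier) (v : EuclideanSpace ℝ (Fin 3)),
    mfderiv (𝓡 3) (𝓡∂ 4) (b₂.incl ∘ ψ) z v ∈ contactPlane J₂.J (b₂.incl (ψ z)) ↔
      mfderiv (𝓡 3) (𝓡∂ 4) b₁.incl z v ∈ contactPlane J₁.J (b₁.incl z)

/-- The identity is a contactomorphism. [folklore] -/
theorem isContacto_refl (J : SteinStructure W₁) (b : BoundaryData (𝓡∂ 4) W₁ (𝓡 3)) :
    IsContacto J J b b (Diffeomorph.refl (𝓡 3) b.carrier ∞) :=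
  fun _ _ => Iff.rfl

end Contacto

/-! ## §2 Contact gluings (cycle 2; LANDED as `Negative/ContactGluing.lean`, p73479) — `IsContacto` wrappers -/

section ContactGluing

variable {W₁ : Type*} [TopologicalSpace W₁] [ChartedSpace (EuclideanHalfSpace 4) W₁]
  [IsManifold (𝓡∂ 4) ∞ W₁] [CompactSpace W₁]
  {W₂ : Type*} [TopologicalSpace W₂] [ChartedSpace (EuclideanHalfSpace 4) W₂]
  [IsManifold (𝓡∂ 4) ∞ W₂] [CompactSpace W₂]

/-- **Gluing two compact Stein domains along a contactomorphism of their boundaries gives a Stein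
bisection along a common contact seam** (the six crux hypotheses) — the landed
`Negative.steinBisection_of_contactGluing` read through `IsContacto`.  Converse half of the lines'
`stub_seam`; generalises `Negative.steinBisection_of_glue` (`ψ = id`, `S₁ = S₂`).  So the crux IS (at
least) "contact twisted doubles `W₁ ∪_ψ W̄₂` of contractible compact Stein domains are `S⁴`". [folklore] -/
theorem steinBisection_of_contactGluing {P : Type*} [TopologicalSpace P]
    [ChartedSpace (EuclideanSpace ℝ (Fin 4)) P]
    (b₁ : BoundaryData (𝓡∂ 4) W₁ (𝓡 3)) (b₂ : BoundaryData (𝓡∂ 4) W₂ (𝓡 3))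
    (S₁ : SteinStructure W₁) (S₂ : SteinStructure W₂)
    (ψ : b₁.carrier ≃ₘ⟮𝓡 3, 𝓡 3⟯ b₂.carrier) (hψ : IsContacto S₁ S₂ b₁ b₂ ψ)
    {jA : W₁ → P} {jB : W₂ → P}
    (hA : Manifold.IsSmoothEmbedding (𝓡∂ 4) (𝓡 4) ∞ jA)
    (hB : Manifold.IsSmoothEmbedding (𝓡∂ 4) (𝓡 4) ∞ jB) (hU : range jA ∪ range jB = univ)
    (hR : ∀ a a', jA a = jB a' ↔ ∃ z, a = b₁.incl z ∧ a' = b₂.incl (ψ z)) :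
    Manifold.IsSmoothEmbedding (𝓡∂ 4) (𝓡 4) ∞ jA ∧ Manifold.IsSmoothEmbedding (𝓡∂ 4) (𝓡 4) ∞ jB ∧
      range jA ∪ range jB = univ ∧ range jA ∩ range jB = jA '' (𝓡∂ 4).boundary W₁ ∧
      range jA ∩ range jB = jB '' (𝓡∂ 4).boundary W₂ ∧
      (∀ w₁ w₂, jA w₁ = jB w₂ →
        Submodule.map (mfderiv (𝓡∂ 4) (𝓡 4) jA w₁).toLinearMap (contactPlane S₁.J w₁) =
          Submodule.map (mfderiv (𝓡∂ 4) (𝓡 4) jB w₂).toLinearMap (contactPlane S₂.J w₂)) :=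
  Negative.steinBisection_of_contactGluing b₁ b₂ S₁ S₂ ψ hψ hA hB hU hR

/-- **crux ⇒ every boundary gluing of two contractible compact Stein domains along a contactomorphism
is `S⁴`** (landed `Negative.contactGluing_standard_of_crux`).  With `ψ = id`, `W₁ = W₂` this is
`Negative.double_standard_of_crux`. [folklore] -/
theorem contactGluing_standard_of_crux (h : ContractibleTwistedDoubleStandard)
    (W₁ : Type) [TopologicalSpace W₁] [ChartedSpace (EuclideanHalfSpace 4) W₁]
    [IsManifold (𝓡∂ 4) ∞ W₁] [CompactSpace W₁] [ContractibleSpace W₁]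
    (W₂ : Type) [TopologicalSpace W₂] [ChartedSpace (EuclideanHalfSpace 4) W₂]
    [IsManifold (𝓡∂ 4) ∞ W₂] [CompactSpace W₂] [ContractibleSpace W₂]
    (S₁ : SteinStructure W₁) (S₂ : SteinStructure W₂)
    (b₁ : BoundaryData (𝓡∂ 4) W₁ (𝓡 3)) (b₂ : BoundaryData (𝓡∂ 4) W₂ (𝓡 3))
    (ψ : b₁.carrier ≃ₘ⟮𝓡 3, 𝓡 3⟯ b₂.carrier) (hψ : IsContacto S₁ S₂ b₁ b₂ ψ)
    (P : Type) [TopologicalSpace P] [T2Space P] [SecondCountableTopology P]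
    [ChartedSpace (EuclideanSpace ℝ (Fin 4)) P] [IsManifold (𝓡 4) ∞ P]
    (hG : IsBoundaryGluing b₁ b₂ ψ (𝓡 4) P) :
    Nonempty (P ≃ₘ⟮𝓡 4, 𝓡 4⟯ (Metric.sphere (0 : EuclideanSpace ℝ (Fin 5)) 1)) :=
  Negative.contactGluing_standard_of_crux h W₁ W₂ S₁ S₂ b₁ b₂ ψ hψ P hG

/-- **crux ⇒ the contact sector of cork twisting `S⁴`** (Gompf arXiv:1603.05090 Q2.2 ∩ contact;
landed `Negative.contactCorkTwist_standard_of_crux`). [folklore] -/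
theorem contactCorkTwist_standard_of_crux (h : ContractibleTwistedDoubleStandard)
    (C : Type) [TopologicalSpace C] [ChartedSpace (EuclideanHalfSpace 4) C]
    [IsManifold (𝓡∂ 4) ∞ C] [CompactSpace C] [ContractibleSpace C]
    (S : SteinStructure C) (b : BoundaryData (𝓡∂ 4) C (𝓡 3))
    (τ : b.carrier ≃ₘ⟮𝓡 3, 𝓡 3⟯ b.carrier) (hτ : IsContacto S S b b τ)
    (P : Type) [TopologicalSpace P] [T2Space P] [SecondCountableTopology P]
    [ChartedSpace (EuclideanSpace ℝ (Fin 4)) P] [IsManifold (𝓡 4) ∞ P]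
    (hG : IsBoundaryGluing b b τ (𝓡 4) P) :
    Nonempty (P ≃ₘ⟮𝓡 4, 𝓡 4⟯ (Metric.sphere (0 : EuclideanSpace ℝ (Fin 5)) 1)) :=
  Negative.contactCorkTwist_standard_of_crux h C S b τ hτ P hG

/-- **Half of the seam lemma, isolated: the crux's matching clause makes the seam map a
contactomorphism** — GIVEN the seam map `ψ` as a diffeomorphism of abstract boundaries intertwining
the two embeddings (`e₂ ∘ incl₂ ∘ ψ = e₁ ∘ incl₁`) and injectivity of `de₁`, `de₂` at boundary points
(both are outputs of the smooth half of `stub_seam`; injectivity of the differential of an immersion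
at BOUNDARY points of a `𝓡∂ 4`-manifold is not yet in the tree — `mfderiv_injective_of_isImmersionAt`
of `DehnSurgeryTubularNbhdProofs.lean` wants a boundaryless source), the matching of pushed-forward
complex tangencies gives `IsContacto`.  Pure linear algebra: `de₁ ∘ d incl₁ = de₂ ∘ d(incl₂ ∘ ψ)`
(chain rule) and cancellation of the injective `deᵢ`.  Converse of the matching part of
`steinBisection_of_contactGluing`; for the prover of `stub_seam`. [folklore] -/
theorem isContacto_of_matching {X : Type*} [TopologicalSpace X]
    [ChartedSpace (EuclideanSpace ℝ (Fin 4)) X]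
    (S₁ : SteinStructure W₁) (S₂ : SteinStructure W₂)
    (b₁ : BoundaryData (𝓡∂ 4) W₁ (𝓡 3)) (b₂ : BoundaryData (𝓡∂ 4) W₂ (𝓡 3))
    {e₁ : W₁ → X} {e₂ : W₂ → X}
    (he₁ : ContMDiff (𝓡∂ 4) (𝓡 4) ∞ e₁) (he₂ : ContMDiff (𝓡∂ 4) (𝓡 4) ∞ e₂)
    (hinj₁ : ∀ z : b₁.carrier, Injective (mfderiv (𝓡∂ 4) (𝓡 4) e₁ (b₁.incl z)))
    (hinj₂ : ∀ y : b₂.carrier, Injective (mfderiv (𝓡∂ 4) (𝓡 4) e₂ (b₂.incl y)))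
    (hC : ∀ w₁ w₂, e₁ w₁ = e₂ w₂ →
      Submodule.map (mfderiv (𝓡∂ 4) (𝓡 4) e₁ w₁).toLinearMap (contactPlane S₁.J w₁) =
        Submodule.map (mfderiv (𝓡∂ 4) (𝓡 4) e₂ w₂).toLinearMap (contactPlane S₂.J w₂))
    (ψ : b₁.carrier ≃ₘ⟮𝓡 3, 𝓡 3⟯ b₂.carrier) (hψ : ∀ z, e₂ (b₂.incl (ψ z)) = e₁ (b₁.incl z)) :
    IsContacto S₁ S₂ b₁ b₂ ψ := by
  intro z v
  have hcomp : e₁ ∘ b₁.incl = e₂ ∘ (b₂.incl ∘ ψ) := funext fun z => (hψ z).symm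
  have hi₁ : MDifferentiableAt (𝓡 3) (𝓡∂ 4) b₁.incl z :=
    b₁.isSmoothEmbedding.contMDiff.mdifferentiableAt (by simp)
  have hi₂ : MDifferentiableAt (𝓡 3) (𝓡∂ 4) (b₂.incl ∘ ψ) z :=
    (b₂.isSmoothEmbedding.contMDiff.comp ψ.contMDiff).mdifferentiableAt (by simp)
  have hjA : MDifferentiableAt (𝓡∂ 4) (𝓡 4) e₁ (b₁.incl z) := he₁.mdifferentiableAt (by simp)
  have hjB : MDifferentiableAt (𝓡∂ 4) (𝓡 4) e₂ ((b₂.incl ∘ ψ) z) := he₂.mdifferentiableAt (by simp)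
  have chain : mfderiv (𝓡∂ 4) (𝓡 4) e₁ (b₁.incl z) (mfderiv (𝓡 3) (𝓡∂ 4) b₁.incl z v) =
      mfderiv (𝓡∂ 4) (𝓡 4) e₂ (b₂.incl (ψ z)) (mfderiv (𝓡 3) (𝓡∂ 4) (b₂.incl ∘ ψ) z v) := by
    rw [← mfderiv_comp_apply z hjA hi₁ v, hcomp]
    exact mfderiv_comp_apply z hjB hi₂ v
  have hm := hC (b₁.incl z) (b₂.incl (ψ z)) (hψ z).symm
  constructor
  · intro h2
    -- membership transported along `hm`; destructured by `whnf` (`Submodule.mem_map` is `Iff.rfl`),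
    -- which avoids instance search on the two syntactically different tangent spaces
    have hmem := (SetLike.ext_iff.mp hm _).mpr (Submodule.mem_map.2 ⟨_, h2, rfl⟩)
    obtain ⟨u, hu, hu'⟩ := hmem
    have : u = mfderiv (𝓡 3) (𝓡∂ 4) b₁.incl z v := hinj₁ z (hu'.trans chain.symm)
    rwa [this] at hu
  · intro h1
    have hmem := (SetLike.ext_iff.mp hm _).mp (Submodule.mem_map.2 ⟨_, h1, rfl⟩)
    obtain ⟨w, hw, hw'⟩ := hmem
    have : w = mfderiv (𝓡 3) (𝓡∂ 4) (b₂.incl ∘ ψ) z v := hinj₂ (ψ z) (hw'.trans chain)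
    rwa [this] at hw

end ContactGluing

/-- **`[CompactSpace X]` and `[SecondCountableTopology X]` are redundant** (landed
`Negative.crux_iff_minimal`). [folklore] -/
theorem crux_iff_minimal : ContractibleTwistedDoubleStandard ↔
    ∀ (X : Type) [TopologicalSpace X] [T2Space X]
      [ChartedSpace (EuclideanSpace ℝ (Fin 4)) X] [IsManifold (𝓡 4) ∞ X]
      (W₁ : Type) [TopologicalSpace W₁] [ChartedSpace (EuclideanHalfSpace 4) W₁]
      [IsManifold (𝓡∂ 4) ∞ W₁] [CompactSpace W₁] [ContractibleSpace W₁]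
      (W₂ : Type) [TopologicalSpace W₂] [ChartedSpace (EuclideanHalfSpace 4) W₂]
      [IsManifold (𝓡∂ 4) ∞ W₂] [CompactSpace W₂] [ContractibleSpace W₂]
      (J₁ : SteinStructure W₁) (J₂ : SteinStructure W₂) (e₁ : W₁ → X) (e₂ : W₂ → X),
      Manifold.IsSmoothEmbedding (𝓡∂ 4) (𝓡 4) ∞ e₁ → Manifold.IsSmoothEmbedding (𝓡∂ 4) (𝓡 4) ∞ e₂ →
      range e₁ ∪ range e₂ = univ →
      range e₁ ∩ range e₂ = e₁ '' (𝓡∂ 4).boundary W₁ →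
      range e₁ ∩ range e₂ = e₂ '' (𝓡∂ 4).boundary W₂ →
      (∀ w₁ w₂, e₁ w₁ = e₂ w₂ →
        Submodule.map (mfderiv (𝓡∂ 4) (𝓡 4) e₁ w₁).toLinearMap (contactPlane J₁.J w₁) =
          Submodule.map (mfderiv (𝓡∂ 4) (𝓡 4) e₂ w₂).toLinearMap (contactPlane J₂.J w₂)) →
      Nonempty (X ≃ₘ⟮𝓡 4, 𝓡 4⟯ Metric.sphere (0 : EuclideanSpace ℝ (Fin 5)) 1) :=
  Negative.crux_iff_minimal


/-! ## §3 The lines' bets, typed, with their exact falsifiers -/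

/-- **BET 1 of line legendrian-r-knot-rigidity (`stub_fillingUniqueness`, verbatim up to the
definitionally equal `IsContacto`)**: contractible compact Stein domains with contactomorphic
Stein-induced boundaries are diffeomorphic by a diffeomorphism restricting to a contactomorphism.
NOT implied by SPC4.  Evidence FOR: seam `S³` (Eliashberg 1990 + Cerf); planar `P₄` seams — Oba
arXiv:1407.5257: unique Stein filling up to diffeomorphism.  Untested elsewhere (AY arXiv:1208.1053
p. 1).  Sharpest instance F1: the exotic contractible Stein Mazur pair of Akbulut–Yildiz
arXiv:1901.00806 Thm 1 / Rmk 1 — if their induced contact structures are contactomorphic this `Prop`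
is FALSE (`not_fillingUniqueness_of_exoticContactFillingPair`). -/
def FillingUniqueness : Prop :=
  ∀ (W₁ : Type) [TopologicalSpace W₁] [T2Space W₁] [SecondCountableTopology W₁]
    [ChartedSpace (EuclideanHalfSpace 4) W₁] [IsManifold (𝓡∂ 4) ∞ W₁] [CompactSpace W₁]
    [ContractibleSpace W₁]
    (W₂ : Type) [TopologicalSpace W₂] [T2Space W₂] [SecondCountableTopology W₂]
    [ChartedSpace (EuclideanHalfSpace 4) W₂] [IsManifold (𝓡∂ 4) ∞ W₂] [CompactSpace W₂]
    [ContractibleSpace W₂]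
    (J₁ : SteinStructure W₁) (J₂ : SteinStructure W₂)
    (b₁ : BoundaryData (𝓡∂ 4) W₁ (𝓡 3)) (b₂ : BoundaryData (𝓡∂ 4) W₂ (𝓡 3))
    (ψ : b₁.carrier ≃ₘ⟮𝓡 3, 𝓡 3⟯ b₂.carrier), IsContacto J₁ J₂ b₁ b₂ ψ →
    ∃ (ψ₀ : b₁.carrier ≃ₘ⟮𝓡 3, 𝓡 3⟯ b₂.carrier) (Φ : W₁ ≃ₘ⟮𝓡∂ 4, 𝓡∂ 4⟯ W₂),
      IsContacto J₁ J₂ b₁ b₂ ψ₀ ∧ ∀ z, Φ (b₁.incl z) = b₂.incl (ψ₀ z)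

/-- **BET 2 of line legendrian-r-knot-rigidity (`stub_contactChirality`, verbatim up to
`IsContacto`)** — also the content of `stub_beltChirality` (legendrian-belt-unlinking) and of the
Mazur bet of property-r-mazur-halves in other clothes: every contactomorphism of the Stein-induced
contact boundary of a contractible compact Stein domain extends to a self-diffeomorphism
(`ExtendsToDiffeomorph`, the cork vocabulary).  NOT implied by SPC4.  TRUE at `𝔻⁴` (contact
orientation + Cerf), an INSTANCE on the Akbulut cork with its handlebody structure (AK 1104.2247),
OPEN for Ukida's planar structure (F0).  FALSE one step outside contractibility (Iida
arXiv:2608.09361 Rmk 10.2, `b₁ > 0`, per the line's planner).  Refuted by any contact cork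
(`not_contactChirality_of_contactCork`). -/
def ContactChirality : Prop :=
  ∀ (W : Type) [TopologicalSpace W] [T2Space W] [SecondCountableTopology W]
    [ChartedSpace (EuclideanHalfSpace 4) W] [IsManifold (𝓡∂ 4) ∞ W] [CompactSpace W]
    [ContractibleSpace W]
    (J : SteinStructure W) (b : BoundaryData (𝓡∂ 4) W (𝓡 3))
    (χ : b.carrier ≃ₘ⟮𝓡 3, 𝓡 3⟯ b.carrier), IsContacto J J b b χ → ExtendsToDiffeomorph b χ

/-- **A CONTACT CORK** (the F0-type object): a cork `(C, τ)` in the tree's sense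
(`Literature.Topology.FourManifolds.IsCork`: compact contractible Hausdorff `C`, `τ` a smooth boundary
involution extending to a homeomorphism but to no diffeomorphism) on a second countable `C`, together
with a Stein structure `J` on `C` for which `τ` is a contactomorphism of `ξ_J`.  None is known
(2026-08-16): for the Akbulut cork and its handlebody Stein structure `τ` moves `c⁺(ξ)` (AK
arXiv:1104.2247 Thm 4.1); for Ukida's planar structure the question is open and HF-blind. -/
def ContactCork : Prop :=
  ∃ (C : Type) (_ : TopologicalSpace C) (_ : SecondCountableTopology C)
    (_ : ChartedSpace (EuclideanHalfSpace 4) C) (_ : IsManifold (𝓡∂ 4) ∞ C) (_ : CompactSpace C)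
    (J : SteinStructure C) (b : BoundaryData (𝓡∂ 4) C (𝓡 3))
    (τ : b.carrier ≃ₘ⟮𝓡 3, 𝓡 3⟯ b.carrier), IsCork b τ ∧ IsContacto J J b b τ

/-- **AN EXOTIC PAIR OF CONTRACTIBLE STEIN FILLINGS OF ONE CONTACT MANIFOLD** (the F1-type object): two
contractible compact Stein domains with `IsContacto`-morphic boundaries and NO diffeomorphism between
them.  None is known with certified contactomorphic boundaries (AY arXiv:1208.1053 p. 1; candidates:
AY arXiv:1901.00806 Thm 1, Hayden–Mark–Piccirillo arXiv:1908.05269 §6, Hayden–Piccirillo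
arXiv:2005.08928 — contact classes uncomputed). -/
def ExoticContactFillingPair : Prop :=
  ∃ (W₁ : Type) (_ : TopologicalSpace W₁) (_ : T2Space W₁) (_ : SecondCountableTopology W₁)
    (_ : ChartedSpace (EuclideanHalfSpace 4) W₁) (_ : IsManifold (𝓡∂ 4) ∞ W₁) (_ : CompactSpace W₁)
    (_ : ContractibleSpace W₁)
    (W₂ : Type) (_ : TopologicalSpace W₂) (_ : T2Space W₂) (_ : SecondCountableTopology W₂)
    (_ : ChartedSpace (EuclideanHalfSpace 4) W₂) (_ : IsManifold (𝓡∂ 4) ∞ W₂) (_ : CompactSpace W₂)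
    (_ : ContractibleSpace W₂)
    (J₁ : SteinStructure W₁) (J₂ : SteinStructure W₂)
    (b₁ : BoundaryData (𝓡∂ 4) W₁ (𝓡 3)) (b₂ : BoundaryData (𝓡∂ 4) W₂ (𝓡 3))
    (ψ : b₁.carrier ≃ₘ⟮𝓡 3, 𝓡 3⟯ b₂.carrier),
    IsContacto J₁ J₂ b₁ b₂ ψ ∧ IsEmpty (W₁ ≃ₘ⟮𝓡∂ 4, 𝓡∂ 4⟯ W₂)

/-- **A contact cork refutes BET 2** (`ContactChirality`, i.e. `stub_contactChirality` and, through
its instance `W₁ = W₂ = C`, `ψ = τ`, `D =` cocore, the bet `stub_beltChirality`): `τ` is a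
contactomorphism of `ξ_J` extending to no diffeomorphism. [folklore] -/
theorem not_contactChirality_of_contactCork (hF0 : ContactCork) : ¬ ContactChirality := by
  intro h
  obtain ⟨C, _, _, _, _, _, J, b, τ, hcork, hτ⟩ := hF0
  haveI : T2Space C := hcork.isLooseCork.2.1
  haveI : ContractibleSpace C := hcork.isLooseCork.contractibleSpace
  exact hcork.not_extendsToDiffeomorph (h C J b τ hτ)

/-- **An exotic pair of contractible Stein fillings of one contact manifold refutes BET 1**
(`FillingUniqueness` = `stub_fillingUniqueness`): no diffeomorphism `W₁ ≅ W₂` exists at all.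
[folklore] -/
theorem not_fillingUniqueness_of_exoticContactFillingPair (hF1 : ExoticContactFillingPair) :
    ¬ FillingUniqueness := by
  intro h
  obtain ⟨W₁, _, _, _, _, _, _, _, W₂, _, _, _, _, _, _, _, J₁, J₂, b₁, b₂, ψ, hψ, hE⟩ := hF1
  obtain ⟨-, Φ, -, -⟩ := h W₁ W₂ J₁ J₂ b₁ b₂ ψ hψ
  exact hE.false Φ

/-- **A contact cork does NOT refute the crux by itself**: given the crux, every Hausdorff second
countable smooth realisation of the twisted double `C ∪_τ C` is `S⁴`
(`contactCorkTwist_standard_of_crux`).  So F0 = YES would kill the three lines (their bets) while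
the crux survives — unless the twisted double is moreover EXOTIC (then SPC4 dies too). [folklore] -/
theorem contactCork_twist_standard_of_crux (h : ContractibleTwistedDoubleStandard)
    (C : Type) [TopologicalSpace C] [SecondCountableTopology C]
    [ChartedSpace (EuclideanHalfSpace 4) C] [IsManifold (𝓡∂ 4) ∞ C] [CompactSpace C]
    (J : SteinStructure C) (b : BoundaryData (𝓡∂ 4) C (𝓡 3))
    (τ : b.carrier ≃ₘ⟮𝓡 3, 𝓡 3⟯ b.carrier) (hcork : IsCork b τ) (hτ : IsContacto J J b b τ)
    (P : Type) [TopologicalSpace P] [T2Space P] [SecondCountableTopology P]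
    [ChartedSpace (EuclideanSpace ℝ (Fin 4)) P] [IsManifold (𝓡 4) ∞ P]
    (hG : IsBoundaryGluing b b τ (𝓡 4) P) :
    Nonempty (P ≃ₘ⟮𝓡 4, 𝓡 4⟯ (Metric.sphere (0 : EuclideanSpace ℝ (Fin 5)) 1)) := by
  haveI : ContractibleSpace C := hcork.isLooseCork.contractibleSpace
  exact contactCorkTwist_standard_of_crux h C J b τ hτ P hG

/-! ## §4 Cycle-1 theorems (landed; imported above — names for the index)

* `Negative.not_crux_without_contractible` (p70693) — CONTRACTIBILITY load-bearing (empty bisection);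
* `Negative.not_crux_without_cover` (p70693) — COVER load-bearing (`S⁴ ⊔ S⁴`);
* `Negative.crux_iff_without_compactSpace` (p70693) — `[CompactSpace X]` redundant (now subsumed by
  `crux_iff_minimal`);
* `Negative.crux_hypotheses_at_sphere`, `Negative.contractibleSpace_closedBall_four` (p69875) —
  non-vacuity / tightness at `S⁴`;
* `Negative.steinBisection_of_isDouble`, `Negative.double_standard_of_crux` (p69875) — doubles are
  Stein bisections; the `ψ = id` sector is forced;
* `Negative.acyclicBisection_sphere` (p70210) — the sibling cruxes are non-vacuous at `S⁴`.
-/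

/-- Sanity anchor: the sphere instance of the landed non-vacuity theorem, re-checked here so that this
index elaborates against the current tree. [folklore] -/
example : ∃ e₁ e₂ : (Metric.closedBall (0 : EuclideanSpace ℝ (Fin 4)) 1) →
    (Metric.sphere (0 : EuclideanSpace ℝ (Fin 5)) 1),
    Manifold.IsSmoothEmbedding (𝓡∂ 4) (𝓡 4) ∞ e₁ ∧ Manifold.IsSmoothEmbedding (𝓡∂ 4) (𝓡 4) ∞ e₂ ∧
      range e₁ ∪ range e₂ = univ ∧
      range e₁ ∩ range e₂ = e₁ '' (𝓡∂ 4).boundary (Metric.closedBall (0 : EuclideanSpace ℝ (Fin 4)) 1) ∧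
      range e₁ ∩ range e₂ = e₂ '' (𝓡∂ 4).boundary (Metric.closedBall (0 : EuclideanSpace ℝ (Fin 4)) 1) ∧
      (∀ w₁ w₂, e₁ w₁ = e₂ w₂ →
        Submodule.map (mfderiv (𝓡∂ 4) (𝓡 4) e₁ w₁).toLinearMap
            (contactPlane steinStructureClosedBall.J w₁) =
          Submodule.map (mfderiv (𝓡∂ 4) (𝓡 4) e₂ w₂).toLinearMap
            (contactPlane steinStructureClosedBall.J w₂)) :=
  Negative.crux_hypotheses_at_sphere

end Summit.SmoothPoincare4.SmoothPoincare4.Cruxes.ContractibleTwistedDoubleStandard.Disproof
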